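import Mathlib
import Summits.Ventures.HodgeRepro2.T6A1Glue
import Summits.Ventures.HodgeRepro2.T6A1WeilCEq

/-!
# T6A1Dict — the A1 share of Layer III: Theorem A's conclusion on a host-shaped carrier

Tier-6 sub-goal A1 (README §10; TARGET-T6.md §2 Layer III, §6 R2; owner t6-p1, gen 2; STATUS l. 5094 (5)).
The interface proves `WeilClassesAlgebraic D` (every element of the rational split Weil line `weilQ K ⊂
H^*(B, ℚ) = ⋀ H¹(B, ℚ)` lies in `D.Alg 2`). The host states «every rational split Weil class of the corner
product is algebraic» on ITS carriers: `H¹ = H¹(B(ℂ), ℂ)` with the `K`-action `act`, `H⁴` with the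
four-fold cup product `cup4`, the rational classes `IsRationalClass` and the algebraic classes
`algebraicClasses B 2`. This file is HOST-FREE: it fixes the three host formulas over abstract carriers
(`eigSub`, `weilSpan`, `SplitWeilAlg` — byte-for-byte the shapes of the lead's `T6Host.eigSub` /
`CornerProduct.weilC` / `SplitWeilAlgebraic`, T6Host filed as v5 p409209), packages the identification `H1Ident` (a `K`-equivariant
`ℂ`-linear isomorphism `φ₁ : H¹(B, ℂ)_model ≃ H¹_host`, the degree-4 map `φ₄` sending wedge monomials to
cup products (Lange–Birkenhake Prop. 1.1.20 / Ex. 1.1.6(7): `⋀⁴ H¹ ≅ H⁴`, injective on `H⁴(B, ℂ)_model`),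
and the rational structure in degree 4 (`IsRationalClass c → c = φ₄ (extC y)`, `y ∈ H⁴(B, ℚ)`; Lange Lemma
1.1.17 / Ex. 1.1.6(7) over `ℤ` + the universal coefficient theorem)), and proves THE TRANSPORT
`splitWeilAlg_of_weilClassesAlgebraic`: under an `H1Ident` whose `φ₄` carries `D.Alg 2` into `alg`,
`WeilClassesAlgebraic D → SplitWeilAlg act cup4 ratl4 alg`. Mathematics: a host class `c = cup4 (v 0) … (v 3)`
with `v i` in the `σ`-eigenspace is `φ₄` of a wedge of vectors of the model eigenspace `V_σ = ⊕_i ℓ_{i,σ}`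
(`K`-equivariance), hence of an element `x` of `weilC F = ⊕_σ ⋀⁴ V_σ` (TIER4 Def. A1.1, `T6A1WeilCEq`);
if `c` is rational, `c = φ₄ (extC y)` with `y` rational of degree 4, so `x = extC y` (injectivity); the
rational Weil projector `p_W` (TIER4 Prop. A2.3: `e_ℂ ∘ extC = extC ∘ p_W`, `e_ℂ = 1` on `W_ℂ`) gives
`extC (p_W y) = e_ℂ x = x` with `p_W y ∈ weilQ K`, so `p_W y ∈ D.Alg 2` by Theorem A's conclusion and
`c = φ₄ (extC (p_W y)) ∈ alg`. No Hodge type enters: the transport of the CONCLUSION needs only the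
`K`-action, the cup product and the rational structure. The constructor `H1Ident.ofLange` builds the
identification from the shape in which the host will supply it (`φ₁`, Lange's `e : ⋀⁴ H¹_host ≃ H⁴_host`
on `exteriorPower.ιMulti`, and the rational classes of `H⁴` as `ℚ`-combinations of cup products of
rational classes of `H¹`). §8(d): uses an L-value-free non-vanishing device: NO.

Filed as p402130 (v1, 279 ll., ACCEPTED 2026-08-25, commit 554f2ccdfe0b; definition lane). v2 replaces the
one in-body «staged» tag on the lead's `T6Host` (filed as v5 p409209, commit 1d50cf1bf2dc) by the filing
reference. Docstrings only: every declaration byte-identical to v1.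
-/

namespace Summit.Ventures.HodgeRepro2.T6.A1Dict

open A1Complex A1ComplexWeil A1WeilCEq A1Glue A1ProjData A2Model

/-! ## 1. The host formulas, host-free -/

section formulas

variable {M : Type*} [Field M] {V1 V4 : Type*} [AddCommGroup V1] [Module ℂ V1] [AddCommGroup V4]
  [Module ℂ V4]

/-- The `τ`-eigenspace of a field action `act : M →+* End(V1)`: the vectors `v` with `act x v = τ x • v`
for every `x ∈ M` (the lead's `T6Host.eigSub` formula). -/
def eigSub (act : M →+* Module.End ℂ V1) (τ : M →+* ℂ) : Submodule ℂ V1 :=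
  ⨅ x : M, Module.End.eigenspace (act x) (τ x)

/-- Membership in `eigSub`: `act x v = τ x • v` for all `x`. -/
theorem mem_eigSub {act : M →+* Module.End ℂ V1} {τ : M →+* ℂ} {v : V1} :
    v ∈ eigSub act τ ↔ ∀ x : M, act x v = τ x • v := by
  simp only [eigSub, Submodule.mem_iInf, Module.End.mem_eigenspace_iff]

/-- The split Weil classes on a host-shaped carrier: the `ℂ`-span, over all embeddings `σ`, of the
four-fold products of `σ`-eigenvectors (the lead's `CornerProduct.weilC` formula; Deligne 1982 §4 /
Milne 2020 Plain 2.1, TIER3 §1.12). -/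
def weilSpan (act : M →+* Module.End ℂ V1) (cup4 : V1 → V1 → V1 → V1 → V4) : Submodule ℂ V4 :=
  ⨆ σ : M →+* ℂ, Submodule.span ℂ
    {w | ∃ v : Fin 4 → V1, (∀ i, v i ∈ eigSub act σ) ∧ w = cup4 (v 0) (v 1) (v 2) (v 3)}

/-- «Every rational split Weil class is algebraic» on a host-shaped carrier (the lead's
`SplitWeilAlgebraic` formula): `ratl c → c ∈ weilSpan → c ∈ alg`. -/
def SplitWeilAlg (act : M →+* Module.End ℂ V1) (cup4 : V1 → V1 → V1 → V1 → V4) (ratl : V4 → Prop)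
    (alg : Submodule ℂ V4) : Prop :=
  ∀ c : V4, ratl c → c ∈ weilSpan act cup4 → c ∈ alg

end formulas

/-! ## 2. Two facts on the interface: eigenspace wedges lie in `weilC`, `extC` preserves degree 4 -/

section interface

variable (K : Type*) [Field K] [NumberField K]

/-- A vector on which `[x]^*_ℂ` is the scalar `σ x` for every `x` lies in the eigenspace
`V_σ = ⊕_i ℓ_{i,σ}`. -/
theorem mem_eigenSpace_of_actH1C {σ : K →+* ℂ} {u : H1C K}
    (hu : ∀ x : K, actH1C K x u = σ x • u) : u ∈ eigenSpace K σ := by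
  rw [mem_eigenSpace]
  intro i
  show ∀ x : K, (Algebra.TensorProduct.includeRight x : KC K) * u i = σ x • u i
  intro x
  have h := congrFun (hu x) i
  rwa [actH1C_apply, Pi.smul_apply] at h

/-- The wedge of four vectors of the eigenspace `V_σ` lies in `weilC F = ⊕_σ ⋀⁴ V_σ`
(TIER4 Def. A1.1; `T6A1WeilCEq.weilC_eq_weilSummandC`). -/
theorem ιMulti_mem_weilC (F : FaceSetting K) (σ : K →+* ℂ) (u : Fin 4 → H1C K)
    (hu : ∀ i, u i ∈ eigenSpace K σ) : ExteriorAlgebra.ιMulti ℂ 4 u ∈ weilC F := by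
  classical
  rw [weilC_eq_weilSummandC]
  refine ⟨exteriorPower.ιMulti ℂ 4 u, Submodule.mem_iSup_of_mem σ ?_, rfl⟩
  rw [weilIdxC_val, A1Monomials.piece_single]
  refine ⟨exteriorPower.ιMulti ℂ 4 fun i => (⟨u i, hu i⟩ : eigenSpace K σ), ?_⟩
  rw [exteriorPower.map_apply_ιMulti]
  rfl

/-- `weilC F ⊆ H⁴(B, ℂ)`. -/
theorem weilC_le_degBC (F : FaceSetting K) : weilC F ≤ degBC K 4 := by
  classical
  rw [weilC_eq_weilSummandC]
  exact Submodule.map_subtype_le _ _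

/-- `extC` takes `H⁴(B, ℚ)` into `H⁴(B, ℂ)`. -/
theorem extC_mem_degBC {y : HB K} (hy : y ∈ degB K 4) : extC K y ∈ degBC K 4 := by
  have hy' : y ∈ Submodule.span ℚ (Set.range (ExteriorAlgebra.ιMulti ℚ 4 (M := H1 K))) := by
    rw [ExteriorAlgebra.ιMulti_span_fixedDegree]; exact hy
  refine Submodule.span_induction (p := fun a _ => extC K a ∈ degBC K 4) ?_ ?_ ?_ ?_ hy'
  · rintro _ ⟨w, rfl⟩
    rw [extC_ιMulti_eq]
    exact ExteriorAlgebra.ιMulti_range ℂ 4 ⟨_, rfl⟩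
  · rw [map_zero]; exact zero_mem _
  · intro a b _ _ ha hb
    rw [map_add]; exact add_mem ha hb
  · intro q a _ ha
    rw [map_smul]; exact Submodule.smul_of_tower_mem _ q ha

end interface

/-! ## 3. The identification `H1Ident` -/

section ident

variable (K : Type*) [Field K] [NumberField K]
variable (V1 V4 : Type*) [AddCommGroup V1] [Module ℂ V1] [AddCommGroup V4] [Module ℂ V4]

/-- THE HODGE-SIDE DICTIONARY (Layer III, A1 share): the model `H¹(B, ℂ) = Fin 4 → K ⊗ ℂ` and
`H⁴(B, ℂ) = ⋀⁴ H¹` against a host-shaped carrier `(V1, act, V4, cup4, ratl4)`. Fields: `φ₁`, a `ℂ`-linear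
isomorphism intertwining the model action `[x]^*_ℂ = actH1C K x` with `act x` (the `K`-action on
`H¹(B(ℂ), ℂ)` by endomorphisms, TIER4 A0.3); `φ₄`, `ℂ`-linear on `H^*(B, ℂ)`, sending a wedge monomial to
the cup product of the images (Lange–Birkenhake Prop. 1.1.20: «the cup product corresponds … to the
exterior product of forms») and injective on `H⁴(B, ℂ)` (Ex. 1.1.6(7): `⋀⁴ H¹ ≅ H⁴`); and the rational
structure in degree 4: every rational class of the host's `H⁴` is `φ₄` of the complexification of a
rational class of the model (Lemma 1.1.17 / Ex. 1.1.6(7) over `ℤ` with the universal coefficient theorem).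
No Hodge type is carried: the transport of Theorem A's conclusion needs none. -/
structure H1Ident (act : K →+* Module.End ℂ V1) (cup4 : V1 → V1 → V1 → V1 → V4)
    (ratl4 : V4 → Prop) where
  /-- the identification of `H¹` -/
  φ₁ : H1C K ≃ₗ[ℂ] V1
  /-- `φ₁` intertwines the `K`-actions -/
  φ₁_act : ∀ (x : K) (v : H1C K), φ₁ (actH1C K x v) = act x (φ₁ v)
  /-- the degree-4 map `H^*(B, ℂ) → H⁴_host` -/
  φ₄ : HBC K →ₗ[ℂ] V4
  /-- wedge monomials go to cup products -/
  φ₄_ιMulti : ∀ v : Fin 4 → H1C K,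
    φ₄ (ExteriorAlgebra.ιMulti ℂ 4 v) = cup4 (φ₁ (v 0)) (φ₁ (v 1)) (φ₁ (v 2)) (φ₁ (v 3))
  /-- `φ₄` is injective on `H⁴(B, ℂ)` -/
  φ₄_inj : ∀ x ∈ degBC K 4, φ₄ x = 0 → x = 0
  /-- every rational class of degree 4 comes from a rational class of the model -/
  ratl4_of : ∀ c : V4, ratl4 c → ∃ y ∈ degB K 4, φ₄ (extC K y) = c

namespace H1Ident

variable {K V1 V4} {act : K →+* Module.End ℂ V1} {cup4 : V1 → V1 → V1 → V1 → V4} {ratl4 : V4 → Prop}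
variable (I : H1Ident K V1 V4 act cup4 ratl4)

/-- A host `σ`-eigenvector comes from the model eigenspace `V_σ`. -/
theorem symm_mem_eigenSpace {σ : K →+* ℂ} {v : V1} (hv : v ∈ eigSub act σ) :
    I.φ₁.symm v ∈ eigenSpace K σ := by
  rw [mem_eigSub] at hv
  refine mem_eigenSpace_of_actH1C K fun x => I.φ₁.injective ?_
  rw [I.φ₁_act, LinearEquiv.apply_symm_apply, hv x, map_smul, LinearEquiv.apply_symm_apply]

/-- The host's split Weil classes are `φ₄` of the model's `weilC F`. -/
theorem weilSpan_le_map (F : FaceSetting K) : weilSpan act cup4 ≤ (weilC F).map I.φ₄ := by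
  refine iSup_le fun σ => Submodule.span_le.2 ?_
  rintro w ⟨v, hv, rfl⟩
  refine ⟨ExteriorAlgebra.ιMulti ℂ 4 (I.φ₁.symm ∘ v),
    ιMulti_mem_weilC K F σ _ (fun i => I.symm_mem_eigenSpace (hv i)), ?_⟩
  rw [I.φ₄_ιMulti]
  simp only [Function.comp_apply, LinearEquiv.apply_symm_apply]

/-- THE TRANSPORT: if `φ₄` carries the algebraic classes `D.Alg 2` of the transfer shadow into `alg`,
Theorem A's conclusion `WeilClassesAlgebraic D` gives «every rational split Weil class of the host
carrier is in `alg`». -/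
theorem splitWeilAlg_of_weilClassesAlgebraic [IsGalois ℚ K] {F : FaceSetting K}
    (D : TransferShadow F) (alg : Submodule ℂ V4) (halg : ∀ y ∈ D.Alg 2, I.φ₄ (extC K y) ∈ alg)
    (hW : WeilClassesAlgebraic D) : SplitWeilAlg act cup4 ratl4 alg := by
  classical
  intro c hc hw
  obtain ⟨x, hx, rfl⟩ := I.weilSpan_le_map F hw
  obtain ⟨y, hy, hyx⟩ := I.ratl4_of _ hc
  obtain ⟨P⟩ := exists_weilProjData K 4
  have hxy : x = extC K y := by
    have hmem : x - extC K y ∈ degBC K 4 :=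
      sub_mem (weilC_le_degBC K F hx) (extC_mem_degBC K hy)
    have h0 : I.φ₄ (x - extC K y) = 0 := by rw [map_sub, hyx, sub_self]
    exact sub_eq_zero.1 (I.φ₄_inj _ hmem h0)
  have hpW : extC K (pW K P y) = x := by
    rw [← eC_extC, ← hxy]
    have hx' : x ∈ weilSummandC' K := by rwa [← weilC_eq_weilSummandC K F]
    obtain ⟨v, hv, rfl⟩ := hx'
    exact eC_coe_of_mem_weilSummandC K P hv
  rw [← hpW]
  exact halg _ (hW _ (pW_mem_weilQ K P hy))

end H1Ident

end ident

/-! ## 4. The constructor from Lange's isomorphism `⋀⁴ H¹_host ≅ H⁴_host` -/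

section ofLange

variable {K : Type*} [Field K] [NumberField K]
variable {V1 V4 : Type*} [AddCommGroup V1] [Module ℂ V1] [AddCommGroup V4] [Module ℂ V4]
variable {act : K →+* Module.End ℂ V1} {cup4 : V1 → V1 → V1 → V1 → V4} {ratl4 : V4 → Prop}

/-- The degree-4 component of `H^*(B, ℂ)`, as a `ℂ`-linear map into `⋀⁴ H¹(B, ℂ)`. -/
noncomputable def proj4C : HBC K →ₗ[ℂ] ⋀[ℂ]^4 (H1C K) :=
  (DirectSum.component ℂ ℕ (fun i : ℕ => ⋀[ℂ]^i (H1C K)) 4) ∘ₗ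
    (DirectSum.decomposeLinearEquiv (fun i : ℕ => ⋀[ℂ]^i (H1C K))).toLinearMap

/-- `proj4C` is the identity on `H⁴(B, ℂ)`. -/
theorem proj4C_of_mem {x : HBC K} (hx : x ∈ degBC K 4) : (proj4C (K := K) x : HBC K) = x := by
  show ((DirectSum.decompose (fun i : ℕ => ⋀[ℂ]^i (H1C K)) x) 4 : HBC K) = x
  exact DirectSum.decompose_of_mem_same _ hx

/-- `proj4C` on a wedge monomial is the exterior-power monomial. -/
theorem proj4C_ιMulti (v : Fin 4 → H1C K) :
    proj4C (K := K) (ExteriorAlgebra.ιMulti ℂ 4 v) = exteriorPower.ιMulti ℂ 4 v := by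
  apply Subtype.ext
  rw [proj4C_of_mem (ExteriorAlgebra.ιMulti_range ℂ 4 ⟨_, rfl⟩)]
  rfl

/-- The degree-4 map built from `φ₁` and Lange's isomorphism `e : ⋀⁴ V1 ≃ V4`. -/
noncomputable def lange4 (φ₁ : H1C K ≃ₗ[ℂ] V1) (e : ⋀[ℂ]^4 V1 ≃ₗ[ℂ] V4) : HBC K →ₗ[ℂ] V4 :=
  e.toLinearMap ∘ₗ exteriorPower.map 4 φ₁.toLinearMap ∘ₗ proj4C

/-- `lange4` on a wedge monomial. -/
theorem lange4_ιMulti (φ₁ : H1C K ≃ₗ[ℂ] V1) (e : ⋀[ℂ]^4 V1 ≃ₗ[ℂ] V4) (v : Fin 4 → H1C K) :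
    lange4 φ₁ e (ExteriorAlgebra.ιMulti ℂ 4 v) = e (exteriorPower.ιMulti ℂ 4 (φ₁ ∘ v)) := by
  simp only [lange4, LinearMap.comp_apply, proj4C_ιMulti, exteriorPower.map_apply_ιMulti,
    LinearEquiv.coe_coe]

/-- `lange4` is injective on `H⁴(B, ℂ)`. -/
theorem lange4_inj (φ₁ : H1C K ≃ₗ[ℂ] V1) (e : ⋀[ℂ]^4 V1 ≃ₗ[ℂ] V4) {x : HBC K}
    (hx : x ∈ degBC K 4) (h0 : lange4 φ₁ e x = 0) : x = 0 := by
  simp only [lange4, LinearMap.comp_apply, LinearEquiv.coe_coe] at h0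
  rw [LinearEquiv.map_eq_zero_iff] at h0
  have h1 : exteriorPower.map 4 φ₁.symm.toLinearMap
      (exteriorPower.map 4 φ₁.toLinearMap (proj4C x)) = 0 := by
    rw [h0, map_zero]
  rw [← LinearMap.comp_apply, ← exteriorPower.map_comp, LinearEquiv.symm_comp, exteriorPower.map_id,
    LinearMap.id_apply] at h1
  rw [← proj4C_of_mem hx, h1, Submodule.coe_zero]

/-- THE CONSTRUCTOR: from `φ₁` (`K`-equivariant) and Lange's isomorphism `e : ⋀⁴ V1 ≃ V4` sending
`exteriorPower.ιMulti ℂ 4 v` to `cup4 (v 0) (v 1) (v 2) (v 3)` (Lange–Birkenhake Prop. 1.1.20 in the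
display's words), with the rational classes of the host's `H⁴` given as `ℚ`-combinations of cup products
of `φ₁`-images of rational model classes (Ex. 1.1.6(7) over `ℤ` + UCT + Lemma 1.1.17). -/
noncomputable def ofLange (φ₁ : H1C K ≃ₗ[ℂ] V1)
    (hφ₁ : ∀ (x : K) (v : H1C K), φ₁ (actH1C K x v) = act x (φ₁ v))
    (e : ⋀[ℂ]^4 V1 ≃ₗ[ℂ] V4)
    (he : ∀ v : Fin 4 → V1, e (exteriorPower.ιMulti ℂ 4 v) = cup4 (v 0) (v 1) (v 2) (v 3))
    (hrat : ∀ c : V4, ratl4 c → ∃ (n : ℕ) (q : Fin n → ℚ) (w : Fin n → Fin 4 → H1 K),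
      c = ∑ i, (q i : ℂ) • cup4 (φ₁ (h1ToC K (w i 0))) (φ₁ (h1ToC K (w i 1)))
        (φ₁ (h1ToC K (w i 2))) (φ₁ (h1ToC K (w i 3)))) :
    H1Ident K V1 V4 act cup4 ratl4 where
  φ₁ := φ₁
  φ₁_act := hφ₁
  φ₄ := lange4 φ₁ e
  φ₄_ιMulti v := by rw [lange4_ιMulti, he]; rfl
  φ₄_inj _ hx h0 := lange4_inj φ₁ e hx h0
  ratl4_of c hc := by
    obtain ⟨n, q, w, rfl⟩ := hrat c hc
    refine ⟨∑ i, q i • ExteriorAlgebra.ιMulti ℚ 4 (w i), ?_, ?_⟩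
    · exact Submodule.sum_mem _ fun i _ =>
        Submodule.smul_mem _ _ (ExteriorAlgebra.ιMulti_range ℚ 4 ⟨_, rfl⟩)
    · rw [map_sum, map_sum]
      refine Finset.sum_congr rfl fun i _ => ?_
      rw [map_smul (extC K), ← algebraMap_smul ℂ (q i) (extC K _), map_smul, extC_ιMulti_eq,
        lange4_ιMulti, he, eq_ratCast]
      rfl

end ofLange

end Summit.Ventures.HodgeRepro2.T6.A1Dict
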